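import Mathlib
import HarnessLib
import Summits.AtomisticToContinuum.FouriersLaw.Theses.VanishingNoiseTransfer

/-!
# `VanishingNoiseTransfer.Assembly` — proved (glue)

Item `stmt-AtomisticToContinuum-11978` (assembly, rank 1, route `VanishingNoiseTransfer`,
sub-problem `FouriersLaw`): the curried type of the route's deciding theorem
`Summit.AtomisticToContinuum.FouriersLaw.Theses.VanishingNoiseTransfer.closes`,

`NoiseLocality → VanishingNoiseBound → NoisyFourier → NessUnique → FiniteResponseOfUnique → FouriersLaw`.

The deciding theorem `closes` is proved sorry-free in the route file itself (planner, rev 3;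
vanishing-noise transfer by an `N`-uniform modulus of continuity of the open-chain resistivity in
the flip-noise strength, pure real analysis over the five hypotheses); the assembly is literally
its curried form, so the witness is `closes` applied to the five hypotheses. No named facts are
used beyond those already inside `closes`.
-/

namespace Summit.AtomisticToContinuum.FouriersLaw.Theorems

/-- Settles `stmt-AtomisticToContinuum-11978` (assembly of route `VanishingNoiseTransfer`):
`NoiseLocality → VanishingNoiseBound → NoisyFourier → NessUnique → FiniteResponseOfUnique →
FouriersLaw`, witnessed by the route's proved deciding theorem `closes`. [folklore] -/
theorem vanishingNoiseTransfer_assembly_proof :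
    Summit.AtomisticToContinuum.FouriersLaw.Theses.VanishingNoiseTransfer.NoiseLocality →
    Summit.AtomisticToContinuum.FouriersLaw.Theses.VanishingNoiseTransfer.VanishingNoiseBound →
    Summit.AtomisticToContinuum.FouriersLaw.Theses.VanishingNoiseTransfer.NoisyFourier →
    Summit.AtomisticToContinuum.FouriersLaw.Theses.VanishingNoiseTransfer.NessUnique →
    Summit.AtomisticToContinuum.FouriersLaw.Theses.VanishingNoiseTransfer.FiniteResponseOfUnique →
    _root_.FouriersLaw :=
  fun hNL hVB hNF hNU hFR =>
    Summit.AtomisticToContinuum.FouriersLaw.Theses.VanishingNoiseTransfer.closes hNL hVB hNF hNU hFR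

end Summit.AtomisticToContinuum.FouriersLaw.Theorems
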